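import Summits.MatrixMultiplication.MatrixMultiplication.Theorems.FarEdgeDescentSignTwistDet
import Mathlib.LinearAlgebra.Matrix.Adjugate
import HarnessLib

/-!
# Slices of a degeneration with polynomial weights, and rank-two factorisation

Route `FarEdgeDescent` (cell `decomp-mm`, lens 2 «structural dichotomy (special vs generic)»,
gen 32), Kernel VIII part 1 (the IMAGE CLASS of a twist); support for the aside `SubLogRate`
(stmt-MatrixMultiplication-25371).

General bookkeeping over `K[ε] = K[X]` for a degeneration `ε^h t + O(ε^{h+1}) = (A⊗B⊗C)·s`
(`IsApproxRestriction h s t A B C`) whose first and third slots have a common index type: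
contracting the entries against a weight vector `ξ ∈ K[ε]^{κ'}` gives the square matrix
`L(ξ) = A · S(y(ξ)) · Cᵀ = ε^h (T(ξ) + ε G)` (`LW_eq_mul`, `LW_eq_smul`), with
`y(ξ) = Bᵀ ξ`, `S(y)_{ac} = ∑_b y_b s_{abc}`, `T(ξ)_{a'c'} = ∑_{b'} ξ_{b'} t_{a'b'c'}`.
Plus: `ε`-adic normalisation of a weight vector (`exists_normalize`), vanishing of the `3 × 3`
minors of a product `P Qᵀ` through `Fin 2` (`det_submatrix_mul_transpose`), and the resulting
rank factorisation through a `2 × 2` block (`rank_factor`, `rank_factor_mulVec`).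

References: P. Bürgisser, M. Clausen, M. A. Shokrollahi, *Algebraic Complexity Theory* (1997),
(15.19), §20.2 [BurgisserClausenShokrollahi1997]; V. Strassen, J. reine angew. Math. 375/376
(1987), §4 [Strassen1987].
-/

noncomputable section

open scoped BigOperators Polynomial Matrix

set_option linter.dupNamespace false

namespace Summit.MatrixMultiplication.MatrixMultiplication.Theorems.FarEdgeDescentTwistImage

open Literature.Computability.AlgebraicComplexity
open Summit.MatrixMultiplication.MatrixMultiplication.Theorems.FarEdgeDescentSignTwistDet
  (entry hd_coeff)

universe u

/-! ## Weighted slices of a degeneration -/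

section Slice
variable {K : Type u} [Field K]
variable {ι κ ι' κ' : Type*} [Fintype ι] [Fintype κ] [Fintype κ']

/-- The substituted middle vector `y(ξ) = Bᵀ ξ`. [folklore] -/
def yW (B : κ' → κ → K[X]) (ξ : κ' → K[X]) (b : κ) : K[X] := ∑ b', B b' b * ξ b'

/-- The `y`-slice `S(y)_{ac} = ∑_b y_b s_{abc}`. [folklore] -/
def SW (s : ι → κ → ι → K) (y : κ → K[X]) : Matrix ι ι K[X] :=
  Matrix.of fun a c => ∑ b, y b * Polynomial.C (s a b c)

/-- The `ξ`-slice `T(ξ)_{a'c'} = ∑_{b'} ξ_{b'} t_{a'b'c'}`. [folklore] -/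
def TW (t : ι' → κ' → ι' → K) (ξ : κ' → K[X]) : Matrix ι' ι' K[X] :=
  Matrix.of fun a' c' => ∑ b', ξ b' * Polynomial.C (t a' b' c')

/-- The `ξ`-slice of `(A ⊗ B ⊗ C)·s` (`entry` = the entries of `(A ⊗ B ⊗ C)·s`, from
`FarEdgeDescentSignTwistDet`). [folklore] -/
def LW (s : ι → κ → ι → K) (A : ι' → ι → K[X]) (B : κ' → κ → K[X]) (C : ι' → ι → K[X])
    (ξ : κ' → K[X]) : Matrix ι' ι' K[X] :=
  Matrix.of fun a' c' => ∑ b', ξ b' * entry s A B C a' b' c'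

/-- **Factorisation of the slice**: `L(ξ) = A · S(y(ξ)) · Cᵀ`. [folklore] -/
theorem LW_eq_mul (s : ι → κ → ι → K) (A : ι' → ι → K[X]) (B : κ' → κ → K[X])
    (C : ι' → ι → K[X]) (ξ : κ' → K[X]) :
    LW s A B C ξ = Matrix.of A * SW s (yW B ξ) * (Matrix.of C)ᵀ := by
  ext a' c' : 1
  have lhs : LW s A B C ξ a' c' = ∑ a, ∑ b, ∑ c, ∑ b',
      ξ b' * (A a' a * B b' b * C c' c * Polynomial.C (s a b c)) := by
    simp only [LW, entry, Matrix.of_apply, Finset.mul_sum]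
    rw [Finset.sum_comm]
    refine Finset.sum_congr rfl fun a _ => ?_
    rw [Finset.sum_comm]
    refine Finset.sum_congr rfl fun b _ => ?_
    rw [Finset.sum_comm]
  have rhs : (Matrix.of A * SW s (yW B ξ) * (Matrix.of C)ᵀ) a' c' = ∑ a, ∑ b, ∑ c, ∑ b',
      ξ b' * (A a' a * B b' b * C c' c * Polynomial.C (s a b c)) := by
    simp only [Matrix.mul_apply, Matrix.transpose_apply, Matrix.of_apply, SW, yW,
      Finset.sum_mul, Finset.mul_sum]
    rw [Finset.sum_comm]
    refine Finset.sum_congr rfl fun a _ => ?_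
    rw [Finset.sum_comm]
    refine Finset.sum_congr rfl fun b _ => ?_
    refine Finset.sum_congr rfl fun c _ => ?_
    refine Finset.sum_congr rfl fun b' _ => ?_
    ring
  rw [lhs, rhs]

variable [DecidableEq ι] [Fintype ι'] [DecidableEq ι'] in
/-- **Determinant of the slice** along a reindexing `e : ι' ≃ ι`. [folklore] -/
theorem det_LW (e : ι' ≃ ι) (s : ι → κ → ι → K) (A : ι' → ι → K[X]) (B : κ' → κ → K[X])
    (C : ι' → ι → K[X]) (ξ : κ' → K[X]) :
    (LW s A B C ξ).det = ((Matrix.of A).submatrix id e).det * (SW s (yW B ξ)).det *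
      ((Matrix.of C).submatrix id e).det := by
  have h1 : LW s A B C ξ = ((Matrix.of A).submatrix id e) * (SW s (yW B ξ)).submatrix e e *
      (((Matrix.of C).submatrix id e))ᵀ := by
    rw [LW_eq_mul, Matrix.transpose_submatrix, Matrix.submatrix_mul_equiv,
      Matrix.submatrix_mul_equiv, Matrix.submatrix_id_id]
  rw [h1, Matrix.det_mul, Matrix.det_mul, Matrix.det_transpose, Matrix.det_submatrix_equiv_self]

omit [Fintype ι] [Fintype κ] in
/-- `y(ξ) = Bᵀ ξ`. [folklore] -/
theorem yW_mulVec (B : κ' → κ → K[X]) (ξ : κ' → K[X]) : yW B ξ = (Matrix.of B)ᵀ *ᵥ ξ := by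
  funext b
  simp [yW, Matrix.mulVec, dotProduct]

omit [Fintype ι] [Fintype κ] in
/-- `y` is linear in `ξ`. [folklore] -/
theorem yW_smul (B : κ' → κ → K[X]) (c : K[X]) (ξ : κ' → K[X]) :
    yW B (c • ξ) = c • yW B ξ := by
  funext b
  simp [yW, Finset.mul_sum, mul_left_comm]

omit [Fintype ι] in
/-- `S` is linear in `y`. [folklore] -/
theorem SW_smul (s : ι → κ → ι → K) (c : K[X]) (y : κ → K[X]) :
    SW s (c • y) = c • SW s y := by
  ext a c'
  simp [SW, Finset.mul_sum, mul_assoc]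

omit [Fintype ι] in
/-- `S(0) = 0`. [folklore] -/
theorem SW_zero (s : ι → κ → ι → K) : SW s (0 : κ → K[X]) = 0 := by
  ext a c
  simp [SW]

/-- `L` is linear in `ξ`. [folklore] -/
theorem LW_smul (s : ι → κ → ι → K) (A : ι' → ι → K[X]) (B : κ' → κ → K[X])
    (C : ι' → ι → K[X]) (c : K[X]) (ξ : κ' → K[X]) :
    LW s A B C (c • ξ) = c • LW s A B C ξ := by
  ext a' c'
  simp [LW, Finset.mul_sum, mul_assoc]

/-- **Order-`h` structure of the slice**: `L(ξ) = ε^h (T(ξ) + ε G)` for a degeneration of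
order `h`. [cite: BurgisserClausenShokrollahi1997, (15.19)] -/
theorem LW_eq_smul {h : ℕ} {s : ι → κ → ι → K} {t : ι' → κ' → ι' → K} {A : ι' → ι → K[X]}
    {B : κ' → κ → K[X]} {C : ι' → ι → K[X]} (hd : IsApproxRestriction h s t A B C)
    (ξ : κ' → K[X]) :
    ∃ G : Matrix ι' ι' K[X],
      LW s A B C ξ = ((Polynomial.X : K[X]) ^ h) • (TW t ξ + (Polynomial.X : K[X]) • G) := by
  have hdiv : ∀ a' b' c', ∃ g : K[X], entry s A B C a' b' c' =
      Polynomial.X ^ h * (Polynomial.C (t a' b' c') + Polynomial.X * g) := by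
    intro a' b' c'
    have hx : Polynomial.X ^ (h + 1) ∣
        entry s A B C a' b' c' - Polynomial.C (t a' b' c') * Polynomial.X ^ h := by
      rw [Polynomial.X_pow_dvd_iff]
      intro d hdlt
      rw [Polynomial.coeff_sub, Polynomial.coeff_C_mul_X_pow]
      unfold entry
      rw [hd_coeff hd a' b' c' d (Nat.lt_succ_iff.mp hdlt), sub_self]
    obtain ⟨g, hg⟩ := hx
    exact ⟨g, by linear_combination hg⟩
  choose g hg using hdiv
  refine ⟨Matrix.of fun a' c' => ∑ b', ξ b' * g a' b' c', ?_⟩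
  ext a' c' : 1
  simp only [LW, TW, Matrix.of_apply, Matrix.smul_apply, Matrix.add_apply, smul_eq_mul, hg,
    mul_add, Finset.mul_sum, ← Finset.sum_add_distrib]
  refine Finset.sum_congr rfl fun b' _ => ?_
  ring

omit [Fintype ι] [Fintype κ] in
/-- **`ε`-adic normalisation** of a nonzero weight vector: `ξ = ε^m ξ'` with `ξ'(0) ≠ 0`.
[folklore] -/
theorem exists_normalize (ξ : κ' → K[X]) (hξ : ξ ≠ 0) :
    ∃ (m : ℕ) (ξ' : κ' → K[X]), ξ = ((Polynomial.X : K[X]) ^ m) • ξ' ∧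
      ∃ b₀, (ξ' b₀).coeff 0 ≠ 0 := by
  classical
  have hne : (Finset.univ.filter fun b => ξ b ≠ 0).Nonempty := by
    by_contra h0
    rw [Finset.not_nonempty_iff_eq_empty, Finset.filter_eq_empty_iff] at h0
    exact hξ (funext fun b => by simpa using h0 (Finset.mem_univ b))
  obtain ⟨b₀, hb₀, hmin⟩ := Finset.exists_min_image _ (fun b => (ξ b).natTrailingDegree) hne
  have hb₀' : ξ b₀ ≠ 0 := (Finset.mem_filter.mp hb₀).2
  set m := (ξ b₀).natTrailingDegree with hm
  have hdvd : ∀ b, (Polynomial.X : K[X]) ^ m ∣ ξ b := by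
    intro b
    by_cases hb : ξ b = 0
    · rw [hb]; exact dvd_zero _
    · rw [Polynomial.X_pow_dvd_iff]
      intro d hd
      exact Polynomial.coeff_eq_zero_of_lt_natTrailingDegree
        (lt_of_lt_of_le hd (hmin b (by simp [hb])))
  choose ξ' hξ' using hdvd
  refine ⟨m, ξ', funext fun b => by rw [Pi.smul_apply, smul_eq_mul]; exact hξ' b, b₀, ?_⟩
  have hc : (ξ b₀).coeff m = (ξ' b₀).coeff 0 := by
    rw [hξ' b₀, Polynomial.coeff_X_pow_mul', if_pos le_rfl, Nat.sub_self]
  rw [← hc]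
  exact fun h0 => hb₀' (Polynomial.trailingCoeff_eq_zero.mp (by
    rw [Polynomial.trailingCoeff, ← hm]; exact h0))

end Slice

/-! ## Rank two: vanishing `3 × 3` minors and factorisation through a `2 × 2` block -/

section Minors
variable {R : Type*} [CommRing R]

/-- A `3 × 3` matrix of the form `P Qᵀ` with `P, Q` of width `2` is singular. [folklore] -/
theorem det3_rank2 (p q : Fin 3 → Fin 2 → R) :
    (Matrix.of fun i j => ∑ k, p i k * q j k).det = 0 := by
  simp only [Matrix.det_fin_three, Matrix.of_apply, Fin.sum_univ_two]
  ring

/-- The `3 × 3` minors of `P Qᵀ` (`P, Q` of width `2`) vanish. [folklore] -/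
theorem det_submatrix_mul_transpose {m : Type*} (P Q : Matrix m (Fin 2) R) (r c : Fin 3 → m) :
    ((P * Qᵀ).submatrix r c).det = 0 := by
  have h1 : (P * Qᵀ).submatrix r c = Matrix.of fun i j => ∑ k, P (r i) k * Q (c j) k := by
    ext i j
    simp [Matrix.mul_apply]
  rw [h1]
  exact det3_rank2 _ _

/-- **Rank factorisation through a `2 × 2` block**: if all `3 × 3` minors of `M` vanish then
`det N · M_{rc} = M_{r,J} · adj N · M_{I,c}` for the block `N = M_{I,J}`. [folklore] -/
theorem rank_factor {m : Type*} (M : Matrix m m R)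
    (hM : ∀ r c : Fin 3 → m, (M.submatrix r c).det = 0) (ρ γ : Fin 2 → m) (r c : m) :
    (M.submatrix ρ γ).det * M r c =
      ∑ k, ∑ l, M r (γ k) * (M.submatrix ρ γ).adjugate k l * M (ρ l) c := by
  have h0 := hM ![ρ 0, ρ 1, r] ![γ 0, γ 1, c]
  simp only [Matrix.det_fin_three, Matrix.submatrix_apply, Matrix.cons_val_zero,
    Matrix.cons_val_one, Matrix.cons_val] at h0
  rw [Matrix.det_fin_two, Matrix.adjugate_fin_two]
  simp only [Fin.sum_univ_two, Matrix.submatrix_apply, Matrix.of_apply, Matrix.cons_val',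
    Matrix.cons_val_zero, Matrix.cons_val_one, Matrix.empty_val', Matrix.cons_val_fin_one]
  linear_combination h0

/-- The factorisation contracted against a vector `x`: `det N · (M x)_r = M_{r,J} · adj N · (M x)_I`.
[folklore] -/
theorem rank_factor_mulVec {m : Type*} [Fintype m] (M : Matrix m m R)
    (hM : ∀ r c : Fin 3 → m, (M.submatrix r c).det = 0) (ρ γ : Fin 2 → m) (x : m → R) (r : m) :
    (M.submatrix ρ γ).det * (M *ᵥ x) r =
      ∑ k, ∑ l, M r (γ k) * (M.submatrix ρ γ).adjugate k l * (M *ᵥ x) (ρ l) := by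
  calc (M.submatrix ρ γ).det * (M *ᵥ x) r
      = ∑ c', (∑ k, ∑ l, M r (γ k) * (M.submatrix ρ γ).adjugate k l * M (ρ l) c') * x c' := by
        simp only [Matrix.mulVec, dotProduct, Finset.mul_sum]
        refine Finset.sum_congr rfl fun c' _ => ?_
        rw [← mul_assoc, rank_factor M hM ρ γ r c']
    _ = ∑ c', ∑ k, ∑ l, M r (γ k) * (M.submatrix ρ γ).adjugate k l * (M (ρ l) c' * x c') := by
        refine Finset.sum_congr rfl fun c' _ => ?_
        rw [Finset.sum_mul]
        refine Finset.sum_congr rfl fun k _ => ?_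
        rw [Finset.sum_mul]
        refine Finset.sum_congr rfl fun l _ => ?_
        ring
    _ = ∑ k, ∑ l, ∑ c', M r (γ k) * (M.submatrix ρ γ).adjugate k l * (M (ρ l) c' * x c') := by
        rw [Finset.sum_comm]
        refine Finset.sum_congr rfl fun k _ => ?_
        rw [Finset.sum_comm]
    _ = ∑ k, ∑ l, M r (γ k) * (M.submatrix ρ γ).adjugate k l * (M *ᵥ x) (ρ l) := by
        simp only [Matrix.mulVec, dotProduct, Finset.mul_sum]

end Minors

end Summit.MatrixMultiplication.MatrixMultiplication.Theorems.FarEdgeDescentTwistImage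

end
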